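import Mathlib
import Summits.Ventures.HodgeRepro.Tier4.Common.AdelicDefs
import Summits.Ventures.HodgeRepro.Tier4.Common.CompactOpenLevel
import Summits.Ventures.HodgeRepro.Tier4.Common.LevelBasis
import Summits.Ventures.HodgeRepro.Tier4.Line1.RTFSetting
import Summits.Ventures.HodgeRepro.Tier4.Line1.OrbitalTools
import Summits.Ventures.HodgeRepro.Tier4.Line1.RationalPoints
import Summits.Ventures.HodgeRepro.Tier4.Line1.RealisedSetting
import Summits.Ventures.HodgeRepro.Tier4.Line1.AdelicParts
import Summits.Ventures.HodgeRepro.Tier4.Line1.IsolatingTestsDeepLevel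
import Summits.Ventures.HodgeRepro.Tier4.Line1.RationalConjFinite
import Summits.Ventures.HodgeRepro.Tier4.Line1.ArchMatrixCoeff
import Summits.Ventures.HodgeRepro.Tier4.Line1.FinLevelCompact

/-!
# Tier4/Line1/FiniteLevelIsolation — ISOLATION FROM THE FINITE PART ALONE (F2″, the neighbourhood form of
finite-adelic J2.b): at a deep enough congruence level `K(N)`, every rational point `γ` with `t⁻¹ γ t′ ∈ γ₀ · (G_∞ · K(N))`
for some `(t, t′)` in the closures of the fundamental domains lies in the rational double coset of `γ₀` — PROVIDED the
archimedean part `G_∞` of `U(W)(𝔸_k)` is compact (DISPLAYED hypothesis, F-L1-ARCH S13818)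

Blind re-derivation cell `pub-hodge-repro`, Tier 4 (README §9–§10), seat t4-L1-p4 (gen 4); t4-plan-1 g2's adjudication
S13794 (a) (the neighbourhood form as the TARGET of the finite half of the F2′ → (S1b) bridge), names S13818 (iii).
Target tree path `lean/Summits/Ventures/HodgeRepro/Tier4/Line1/FiniteLevelIsolation.lean`.  No printed input.

WHAT THIS IS.  `infinitePart W ≤ U(W)(𝔸_k)` is the subgroup of elements whose FINITE part is the identity (`finM = 1`),
closed in `G(𝔸_k)`.  `exists_level_isolating_of_compact`: for a definite, row-genuine plane, a linearly regular rational
`γ₀`, and `hcomp : IsCompact (infinitePart W)`, there is `N ≠ 0` such that for all `t ∈ closure DT`, `t′ ∈ closure DT′` and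
rational `γ`, `t⁻¹ γ t′ ∈ γ₀ • (infinitePart W * levelK W N)` implies `orbitOf γ = orbitOf γ₀`: the isolating neighbourhood
of J2.d′ can be taken with NO archimedean condition — the whole archimedean fibre `G_∞` over the finite-adelic double
coset neighbourhood `γ₀,f K(N)`.  THE PROOF: the rational points hit by the compact set `γ₀ • (G_∞ · K(1))` on
`closure DT × closure DT′` are finitely many (p2's `finite_hit_closure`, discreteness of `G(k)`); for each of them outside
`orbitOf γ₀` the compact set `C_γ = γ₀⁻¹ · {t⁻¹ γ t′}` misses `G_∞` (finite-adelic J2.b, `orbitOf_eq_of_finPart_conj`,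
contrapositive), so `G_∞ ⊆ C_γᶜ` open, `G_∞ · V ⊆ C_γᶜ` for a neighbourhood `V` of `1` (`compact_open_separated_mul_right`,
where COMPACTNESS of `G_∞` enters) and `K(N_γ) ⊆ V` (LevelBasis); `N := ∏ N_γ` works by `levelK_antitone`.
THE FORM OF RECORD (t4-plan-1 S13820: p2's vocabulary): `exists_level_isolating (hC : IsCompact (archImage W)) …` with the
neighbourhood `γ₀ • finLevel W N` (p2's `K_f(N) × G(k_∞)`, ArchMatrixCoeff / FinLevelCompact p685546), derived from the
`infinitePart W * levelK W N` form through the FACTORISATION `g = g_∞ · g_f` of an element of `U(W)(𝔸_k)` into its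
archimedean and finite parts (`GA.ofInfPart`, `GA.ofFinPart`, `finLevel_subset_mul`) and `isCompact_infinitePart_of_archImage`
(`G_∞` is closed in the compact `finLevel W 1`).  DISCLOSED: `finM` / `infM` / `mixM` of AdelicParts (p686166) are the same
maps as p2's `finPartMat` / `infPartMat` / `zipMat` (p685546, landed while AdelicParts was being built); `finM_eq_finPartMat`
records the identity; nothing of p2's is restated here.
WHY THE HYPOTHESIS IS DISPLAYED (F-L1-ARCH).  `IsDefinite` (PlaneDefs) is definiteness at ONE real embedding; when the plane
is indefinite at another real place, `G_∞` is not compact, the arithmetic group `G(k) ∩ (K(N) × G_∞)` is infinite, and the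
statement is false in general; on a TOTALLY definite plane `G_∞` is compact and the hypothesis holds (not proved here).
Nothing here says anything about the status of the Hodge conjecture for CM abelian varieties, which is NOT proved
(HC_CM is NOT proved by anyone in this repository).
-/

set_option autoImplicit false

noncomputable section

namespace Summit.Ventures.HodgeRepro.Tier4.Line1

open Matrix NumberField IsDedekindDomain Topology Summit.Ventures.HodgeRepro.Tier4.Common
open scoped NumberField Pointwise

/-! ### The archimedean part `G_∞` -/

section ArchPart

variable {k : Type} [Field k] [NumberField k] (W : PlaneData k)

/-- **The archimedean part `G_∞ ≤ U(W)(𝔸_k)`**: the elements whose finite part is the identity. -/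
def infinitePart : Subgroup (GA W) where
  carrier := {g | finM k (GA.mat W g) = 1}
  one_mem' := by
    show finM k (GA.mat W 1) = 1
    exact finM_one
  mul_mem' := by
    intro a b ha hb
    show finM k (GA.mat W (a * b)) = 1
    change finM k (GA.mat W a) = 1 at ha
    change finM k (GA.mat W b) = 1 at hb
    rw [GA.mat_mul, finM_mul, ha, hb, Matrix.one_mul]
  inv_mem' := by
    intro a ha
    show finM k (GA.mat W a⁻¹) = 1
    change finM k (GA.mat W a) = 1 at ha
    have h := congrArg (finM k) (GA.mat_inv_mul W a)
    rwa [finM_mul, finM_one, ha, Matrix.mul_one] at h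

/-- membership in `G_∞`: the finite part is `1` -/
theorem mem_infinitePart (g : GA W) : g ∈ infinitePart W ↔ finM k (GA.mat W g) = 1 := Iff.rfl

/-- `G_∞` is closed in `U(W)(𝔸_k)` (the finite-part entries are continuous, `𝔸_{k,f}` is Hausdorff) -/
theorem isClosed_infinitePart : IsClosed (infinitePart W : Set (GA W)) := by
  haveI := t2Space_finiteAdeleRing k
  have h : (infinitePart W : Set (GA W)) = ⋂ i, ⋂ j,
      {g : GA W | finPart k (GA.mat W g i j) = (1 : Matrix (Fin 4) (Fin 4) (FiniteAdeleRing (𝓞 k) k)) i j} := by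
    ext g
    simp only [SetLike.mem_coe, Set.mem_iInter, Set.mem_setOf_eq]
    change finM k (GA.mat W g) = 1 ↔ _
    constructor
    · intro hg i j
      exact congrFun (congrFun hg i) j
    · intro hg
      apply Matrix.ext
      intro i j
      exact hg i j
  rw [h]
  refine isClosed_iInter fun i => isClosed_iInter fun j => isClosed_eq ?_ continuous_const
  exact continuous_finPart.comp ((Units.continuous_val.comp continuous_subtype_val).matrix_elem i j)

end ArchPart

/-! ### The factorisation `g = g_∞ · g_f` -/

section Factor

variable {k : Type} [Field k] [NumberField k] (W : PlaneData k)

/-- `finM` is p2's `finPartMat` (FinLevelCompact) -/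
theorem finM_eq_finPartMat (M : M4 k) : finM k M = finPartMat k M := rfl

/-- `infM` is p2's `infPartMat` (FinLevelCompact) -/
theorem infM_eq_infPartMat (M : M4 k) : infM k M = infPartMat k M := rfl

/-- the archimedean part of a transpose -/
theorem infM_transpose (M : M4 k) : infM k Mᵀ = (infM k M)ᵀ := Matrix.transpose_map (f := infPart k) (M := M)

/-- the finite part of `g` as an element of `U(W)(𝔸_k)` (archimedean part the identity) -/
def GA.ofFinPart (g : GA W) : GA W :=
  ⟨⟨mixM k 1 (finM k (GA.mat W g)), mixM k 1 (finM k (GA.mat W g⁻¹)),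
    by
      apply M4_ext
      · simp only [infM_mul, infM_mixM, infM_one, Matrix.one_mul]
      · rw [finM_mul, finM_mixM, finM_mixM, ← finM_mul, GA.mat_mul_inv, finM_one],
    by
      apply M4_ext
      · simp only [infM_mul, infM_mixM, infM_one, Matrix.one_mul]
      · rw [finM_mul, finM_mixM, finM_mixM, ← finM_mul, GA.mat_inv_mul, finM_one]⟩,
    by
      have hΩ := ((mem_unitaryGroup W _).1 g.2).1
      have hB := ((mem_unitaryGroup W _).1 g.2).2
      refine ⟨?_, ?_⟩
      · change mixM k 1 (finM k (GA.mat W g)) * adMat k W.Ω = adMat k W.Ω * mixM k 1 (finM k (GA.mat W g))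
        apply M4_ext
        · simp only [infM_mul, infM_mixM, Matrix.one_mul, Matrix.mul_one]
        · rw [finM_mul, finM_mul, finM_mixM, ← finM_mul, hΩ, finM_mul]
      · change mixM k 1 (finM k (GA.mat W g)) * adMat k W.B * (mixM k 1 (finM k (GA.mat W g)))ᵀ = adMat k W.B
        apply M4_ext
        · simp only [infM_mul, infM_transpose, infM_mixM, Matrix.one_mul, Matrix.transpose_one, Matrix.mul_one]
        · rw [finM_mul, finM_mul, finM_transpose, finM_mixM, ← finM_transpose, ← finM_mul, ← finM_mul, hB]⟩

/-- the archimedean part of `g` as an element of `U(W)(𝔸_k)` (finite part the identity) -/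
def GA.ofInfPart (g : GA W) : GA W :=
  ⟨⟨mixM k (infM k (GA.mat W g)) 1, mixM k (infM k (GA.mat W g⁻¹)) 1,
    by
      apply M4_ext
      · rw [infM_mul, infM_mixM, infM_mixM, ← infM_mul, GA.mat_mul_inv, infM_one]
      · simp only [finM_mul, finM_mixM, finM_one, Matrix.one_mul],
    by
      apply M4_ext
      · rw [infM_mul, infM_mixM, infM_mixM, ← infM_mul, GA.mat_inv_mul, infM_one]
      · simp only [finM_mul, finM_mixM, finM_one, Matrix.one_mul]⟩,
    by
      have hΩ := ((mem_unitaryGroup W _).1 g.2).1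
      have hB := ((mem_unitaryGroup W _).1 g.2).2
      refine ⟨?_, ?_⟩
      · change mixM k (infM k (GA.mat W g)) 1 * adMat k W.Ω = adMat k W.Ω * mixM k (infM k (GA.mat W g)) 1
        apply M4_ext
        · rw [infM_mul, infM_mul, infM_mixM, ← infM_mul, hΩ, infM_mul]
        · simp only [finM_mul, finM_mixM, Matrix.one_mul, Matrix.mul_one]
      · change mixM k (infM k (GA.mat W g)) 1 * adMat k W.B * (mixM k (infM k (GA.mat W g)) 1)ᵀ = adMat k W.B
        apply M4_ext
        · rw [infM_mul, infM_mul, infM_transpose, infM_mixM, ← infM_transpose, ← infM_mul, ← infM_mul, hB]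
        · simp only [finM_mul, finM_transpose, finM_mixM, Matrix.one_mul, Matrix.transpose_one, Matrix.mul_one]⟩

/-- the matrix of `GA.ofFinPart g` -/
theorem GA.mat_ofFinPart (g : GA W) : GA.mat W (GA.ofFinPart W g) = mixM k 1 (finM k (GA.mat W g)) := rfl

/-- the matrix of `GA.ofInfPart g` -/
theorem GA.mat_ofInfPart (g : GA W) : GA.mat W (GA.ofInfPart W g) = mixM k (infM k (GA.mat W g)) 1 := rfl

/-- **the factorisation `g = g_∞ · g_f`** -/
theorem GA.ofInfPart_mul_ofFinPart (g : GA W) : GA.ofInfPart W g * GA.ofFinPart W g = g := by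
  apply Subtype.ext
  apply Units.ext
  change GA.mat W (GA.ofInfPart W g) * GA.mat W (GA.ofFinPart W g) = GA.mat W g
  rw [GA.mat_ofInfPart, GA.mat_ofFinPart]
  apply M4_ext
  · simp only [infM_mul, infM_mixM, Matrix.mul_one]
  · simp only [finM_mul, finM_mixM, Matrix.one_mul]

/-- `g_∞ ∈ G_∞` -/
theorem GA.ofInfPart_mem_infinitePart (g : GA W) : GA.ofInfPart W g ∈ infinitePart W := by
  rw [mem_infinitePart, GA.mat_ofInfPart, finM_mixM]

/-- `g_f ∈ K(N)` when `g ∈ K_f(N) × G(k_∞)` -/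
theorem GA.ofFinPart_mem_levelK {N : ℕ} {g : GA W} (hg : g ∈ finLevel W N) : GA.ofFinPart W g ∈ levelK W N := by
  obtain ⟨h1, h2⟩ := (mem_finLevel W N g).1 hg
  rw [mem_levelK]
  refine ⟨fun i j => ⟨?_, ?_⟩, fun i j => ⟨?_, ?_⟩⟩
  · show infPart k ((mixM k 1 (finM k (GA.mat W g)) - 1) i j) = 0
    rw [Matrix.sub_apply, map_sub, sub_eq_zero]
    exact congrFun (congrFun ((infM_mixM (k := k) 1 (finM k (GA.mat W g))).trans (infM_one (k := k)).symm) i) j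
  · show finPart k ((mixM k 1 (finM k (GA.mat W g)) - 1) i j) ∈ modSet k N
    have := h1 i j
    rw [mem_finCongrSet, Matrix.sub_apply, map_sub] at this
    rw [Matrix.sub_apply, map_sub]
    exact this
  · show infPart k ((GA.mat W (GA.ofFinPart W g)⁻¹ - 1) i j) = 0
    change infPart k ((mixM k 1 (finM k (GA.mat W g⁻¹)) - 1) i j) = 0
    rw [Matrix.sub_apply, map_sub, sub_eq_zero]
    exact congrFun (congrFun ((infM_mixM (k := k) 1 (finM k (GA.mat W g⁻¹))).trans (infM_one (k := k)).symm) i) j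
  · show finPart k ((GA.mat W (GA.ofFinPart W g)⁻¹ - 1) i j) ∈ modSet k N
    change finPart k ((mixM k 1 (finM k (GA.mat W g⁻¹)) - 1) i j) ∈ modSet k N
    have := h2 i j
    rw [mem_finCongrSet, Matrix.sub_apply, map_sub] at this
    rw [Matrix.sub_apply, map_sub]
    exact this

/-- **`K_f(N) × G(k_∞) ⊆ G_∞ · K(N)`** (the factorisation, as sets) -/
theorem finLevel_subset_mul (N : ℕ) :
    (finLevel W N : Set (GA W)) ⊆ (infinitePart W : Set (GA W)) * (levelK W N : Set (GA W)) := by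
  intro g hg
  rw [← GA.ofInfPart_mul_ofFinPart W g]
  exact Set.mul_mem_mul (GA.ofInfPart_mem_infinitePart W g) (GA.ofFinPart_mem_levelK W hg)

/-- `G_∞` is compact when the archimedean image is (p2's `isCompact_finLevel` at level `1`; `G_∞ ⊆ finLevel W 1`) -/
theorem isCompact_infinitePart_of_archImage (hC : IsCompact (archImage W)) :
    IsCompact (infinitePart W : Set (GA W)) := by
  refine (isCompact_finLevel W hC one_ne_zero).of_isClosed_subset (isClosed_infinitePart W) ?_
  intro g hg
  rw [SetLike.mem_coe, mem_infinitePart] at hg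
  rw [SetLike.mem_coe, mem_finLevel]
  have hg' : finM k (GA.mat W g⁻¹) = 1 := by
    have h := congrArg (finM k) (GA.mat_inv_mul W g)
    rwa [finM_mul, finM_one, hg, Matrix.mul_one] at h
  refine ⟨fun i j => ?_, fun i j => ?_⟩
  · rw [mem_finCongrSet, Matrix.sub_apply, map_sub]
    have e1 : finPart k (GA.mat W g i j) = finPart k ((1 : M4 k) i j) :=
      (congrFun (congrFun hg i) j).trans (congrFun (congrFun (finM_one (k := k)) i) j).symm
    rw [e1, sub_self]
    exact zero_mem_modSet k 1
  · rw [mem_finCongrSet, Matrix.sub_apply, map_sub]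
    have e1 : finPart k (GA.mat W g⁻¹ i j) = finPart k ((1 : M4 k) i j) :=
      (congrFun (congrFun hg' i) j).trans (congrFun (congrFun (finM_one (k := k)) i) j).symm
    rw [e1, sub_self]
    exact zero_mem_modSet k 1

end Factor

/-! ### Isolation from the finite part alone -/

section Isolation

open MeasureTheory

variable {k : Type} [Field k] [NumberField k] (W : PlaneData k) [MeasurableSpace (GA W)] [BorelSpace (GA W)]
  (hW : IsDefinite W) (hg : IsGenuineRow W) (R : RTFData W) (μ : Measure (GA W)) [μ.IsHaarMeasure]
  [R.μT.IsHaarMeasure] [R.μT'.IsHaarMeasure] (hT : IsCompact (closure R.DT)) (hT' : IsCompact (closure R.DT'))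

/-- **F2″ — isolation from the finite part alone** (see the module docstring): under `hcomp : IsCompact G_∞` there is a
level `N ≠ 0` such that every rational `γ` with `t⁻¹ γ t′ ∈ γ₀ • (G_∞ · K(N))` for some `t ∈ closure DT`,
`t′ ∈ closure DT′` lies in the rational double coset of `γ₀`. -/
theorem exists_level_isolating_of_compact (hcomp : IsCompact (infinitePart W : Set (GA W)))
    (γ₀ : rationalPoints W) (hreg : IsLinRegular W γ₀) :
    ∃ N : ℕ, N ≠ 0 ∧ ∀ t ∈ closure (Setting.ofAdelic W hW hg R μ hT hT').DT,
      ∀ t' ∈ closure (Setting.ofAdelic W hW hg R μ hT hT').DT', ∀ γ : (Setting.ofAdelic W hW hg R μ hT hT').Gk,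
        (t : GA W)⁻¹ * γ * t' ∈ (γ₀ : GA W) • ((infinitePart W : Set (GA W)) * (levelK W N : Set (GA W))) →
        (Setting.ofAdelic W hW hg R μ hT hT').orbitOf γ = (Setting.ofAdelic W hW hg R μ hT hT').orbitOf γ₀ := by
  classical
  haveI : T2Space (GA W) := t2Space_GA W
  -- the compact set at level `1` and the finite set of rational points it hits
  have hK1 : IsCompact (levelK W 1 : Set (GA W)) := isCompact_levelK W one_ne_zero
  have hM : IsCompact ((γ₀ : GA W) • ((infinitePart W : Set (GA W)) * (levelK W 1 : Set (GA W)))) :=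
    (hcomp.mul hK1).smul _
  -- for every rational point outside the double coset of `γ₀`, a level that separates it
  have hbad : ∀ γ : (Setting.ofAdelic W hW hg R μ hT hT').Gk,
      (Setting.ofAdelic W hW hg R μ hT hT').orbitOf γ ≠ (Setting.ofAdelic W hW hg R μ hT hT').orbitOf γ₀ →
      ∃ Nγ : ℕ, Nγ ≠ 0 ∧ ∀ t ∈ closure (Setting.ofAdelic W hW hg R μ hT hT').DT,
        ∀ t' ∈ closure (Setting.ofAdelic W hW hg R μ hT hT').DT',
        (t : GA W)⁻¹ * γ * t' ∉ (γ₀ : GA W) • ((infinitePart W : Set (GA W)) * (levelK W Nγ : Set (GA W))) := by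
    intro γ hne
    have hA : IsCompact ((fun t : (Setting.ofAdelic W hW hg R μ hT hT').T => (t : GA W)) ''
        closure (Setting.ofAdelic W hW hg R μ hT hT').DT) :=
      (Setting.ofAdelic W hW hg R μ hT hT').compT.image continuous_subtype_val
    have hB : IsCompact ((fun t : (Setting.ofAdelic W hW hg R μ hT hT').T' => (t : GA W)) ''
        closure (Setting.ofAdelic W hW hg R μ hT hT').DT') :=
      (Setting.ofAdelic W hW hg R μ hT hT').compT'.image continuous_subtype_val
    -- the compact set `C = γ₀⁻¹ · {t⁻¹ γ t′}`
    set C : Set (GA W) := (fun p : GA W × GA W => (γ₀ : GA W)⁻¹ * (p.1⁻¹ * γ * p.2)) ''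
      (((fun t : (Setting.ofAdelic W hW hg R μ hT hT').T => (t : GA W)) ''
          closure (Setting.ofAdelic W hW hg R μ hT hT').DT) ×ˢ
        ((fun t : (Setting.ofAdelic W hW hg R μ hT hT').T' => (t : GA W)) ''
          closure (Setting.ofAdelic W hW hg R μ hT hT').DT')) with hCdef
    have hC : IsCompact C :=
      (hA.prod hB).image (continuous_const.mul ((continuous_fst.inv.mul continuous_const).mul continuous_snd))
    -- `C` misses `G_∞`: finite-adelic J2.b
    have hdisj : ∀ t ∈ closure (Setting.ofAdelic W hW hg R μ hT hT').DT,
        ∀ t' ∈ closure (Setting.ofAdelic W hW hg R μ hT hT').DT',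
        (γ₀ : GA W)⁻¹ * ((t : GA W)⁻¹ * γ * t') ∉ infinitePart W := by
      intro t _ t' _ hmem
      apply hne
      have h1 : finM k (GA.mat W ((t : GA W)⁻¹ * γ * t')) = finM k (GA.mat W (γ₀ : GA W)) := by
        have hm := (mem_infinitePart W _).1 hmem
        rw [GA.mat_mul, finM_mul] at hm
        calc finM k (GA.mat W ((t : GA W)⁻¹ * γ * t'))
            = (finM k (GA.mat W (γ₀ : GA W)) * finM k (GA.mat W (γ₀ : GA W)⁻¹)) *
                finM k (GA.mat W ((t : GA W)⁻¹ * γ * t')) := by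
              rw [← finM_mul, GA.mat_mul_inv, finM_one, Matrix.one_mul]
          _ = finM k (GA.mat W (γ₀ : GA W)) *
                (finM k (GA.mat W (γ₀ : GA W)⁻¹) * finM k (GA.mat W ((t : GA W)⁻¹ * γ * t'))) :=
              Matrix.mul_assoc _ _ _
          _ = finM k (GA.mat W (γ₀ : GA W)) := by rw [hm, Matrix.mul_one]
      exact orbitOf_eq_of_finPart_conj W hW hg R μ hT hT' γ γ₀ hreg t.2 t'.2
        (fun i j => congrFun (congrFun h1 i) j)
    have hU : IsOpen Cᶜ := hC.isClosed.isOpen_compl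
    have hsub : (infinitePart W : Set (GA W)) ⊆ Cᶜ := by
      rintro a ha ⟨⟨_, _⟩, ⟨⟨τ, hτ, rfl⟩, ⟨τ', hτ', rfl⟩⟩, hfa⟩
      rw [← hfa] at ha
      exact hdisj τ hτ τ' hτ' ha
    obtain ⟨V, hV, hVsub⟩ := compact_open_separated_mul_right hcomp hU hsub
    obtain ⟨Nγ, hNγ, hKV⟩ := exists_levelK_subset_nhds_one W hV
    refine ⟨Nγ, hNγ, fun t ht t' ht' hmem => ?_⟩
    rw [Set.mem_smul_set_iff_inv_smul_mem, smul_eq_mul] at hmem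
    have hin : (γ₀ : GA W)⁻¹ * ((t : GA W)⁻¹ * γ * t') ∈ C :=
      ⟨((t : GA W), (t' : GA W)), ⟨⟨t, ht, rfl⟩, ⟨t', ht', rfl⟩⟩, rfl⟩
    exact hVsub (Set.mul_subset_mul_left hKV hmem) hin
  choose! Nf hNf using hbad
  -- the finite set of rational points hit at level `1`, and the product level over its bad members
  set Γ : Finset (Setting.ofAdelic W hW hg R μ hT hT').Gk :=
    ((Setting.ofAdelic W hW hg R μ hT hT').finite_hit_closure hM).toFinset with hΓ
  set N : ℕ := ∏ γ ∈ Γ.filter (fun γ =>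
    (Setting.ofAdelic W hW hg R μ hT hT').orbitOf γ ≠ (Setting.ofAdelic W hW hg R μ hT hT').orbitOf γ₀), Nf γ
    with hN
  refine ⟨N, ?_, ?_⟩
  · rw [hN, Finset.prod_ne_zero_iff]
    intro γ hγ
    exact (hNf γ (Finset.mem_filter.1 hγ).2).1
  · intro t ht t' ht' γ hmem
    by_contra hne
    have hγΓ : γ ∈ Γ := by
      rw [hΓ, Set.Finite.mem_toFinset]
      refine ⟨t, ht, t', ht', ?_⟩
      exact Set.smul_set_mono
        (Set.mul_subset_mul_left (SetLike.coe_subset_coe.2 (levelK_antitone W (one_dvd N)))) hmem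
    have hdvd : Nf γ ∣ N := Finset.dvd_prod_of_mem _ (Finset.mem_filter.2 ⟨hγΓ, hne⟩)
    exact (hNf γ hne).2 t ht t' ht'
      (Set.smul_set_mono (Set.mul_subset_mul_left (SetLike.coe_subset_coe.2 (levelK_antitone W hdvd))) hmem)

/-- **F2″ in the form of record** (t4-plan-1 S13820): with `hC : IsCompact (archImage W)` — p2's typed form of «the
archimedean group is compact», true on totally definite planes — there is a level `N ≠ 0` such that every rational `γ`
with `t⁻¹ γ t′ ∈ γ₀ • (K_f(N) × G(k_∞))` for some `t ∈ closure DT`, `t′ ∈ closure DT′` lies in the rational double coset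
of `γ₀` (`finLevel W N ⊆ G_∞ · K(N)` by the factorisation). -/
theorem exists_level_isolating (hC : IsCompact (archImage W)) (γ₀ : rationalPoints W) (hreg : IsLinRegular W γ₀) :
    ∃ N : ℕ, N ≠ 0 ∧ ∀ t ∈ closure (Setting.ofAdelic W hW hg R μ hT hT').DT,
      ∀ t' ∈ closure (Setting.ofAdelic W hW hg R μ hT hT').DT', ∀ γ : (Setting.ofAdelic W hW hg R μ hT hT').Gk,
        (t : GA W)⁻¹ * γ * t' ∈ (γ₀ : GA W) • (finLevel W N : Set (GA W)) →
        (Setting.ofAdelic W hW hg R μ hT hT').orbitOf γ = (Setting.ofAdelic W hW hg R μ hT hT').orbitOf γ₀ := by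
  obtain ⟨N, hN, h⟩ := exists_level_isolating_of_compact W hW hg R μ hT hT'
    (isCompact_infinitePart_of_archImage W hC) γ₀ hreg
  exact ⟨N, hN, fun t ht t' ht' γ hmem => h t ht t' ht' γ (Set.smul_set_mono (finLevel_subset_mul W N) hmem)⟩

end Isolation

end Summit.Ventures.HodgeRepro.Tier4.Line1

end
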